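import Summits.Ventures.PercRepro.S2CubeMultiplicityA

/-!
# PercRepro — S2: THE CUBIC MULTIPLICITY, PART B — «not every pair is bad» and the three-point case
(p4, gen 16; paper proofs/P4-MULT-CUBE.md §2 (e), (f))

With `W` the union of the supports of the extras `T`: if every pair of `W` were bad, the induction
`r((I ∖ S) ∪ T) = |I| − |S| + 1` over `S ⊆ W` (`eRk_sdiff_union_step` of Part A) would give at `S = W` a set
`(I ∖ W) ∪ {e}` whose closure holds `f` — impossible for two distinct extras when every circuit has `≥ 3` elements
(`false_of_eRk_sdiff_union_eq`); hence some pair is good (`exists_mem_closure_sdiff_pair_union`). When `|W| = 3`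
every pair of `W` is good: a bad pair would put the four points `T ∪ {c}` on a rank-`2` set
(`mem_closure_sdiff_pair_union_of_card_three`, lines `≤ 3` points). Axioms: standard.
-/

open scoped Matroid

namespace PercRepro

namespace S2

open Set

variable {α : Type} {M : Matroid α}

/-- Every extra lies in the closure of the support union `W` (`W ⊇ C(t, I) ∖ {t}` for every `t ∈ T`). -/
theorem mem_closure_coe_of_mem_extras {I W : Finset α} {T : Set α} {t : α}
    (hI : M.Indep (I : Set α)) (hTcl : T ⊆ M.closure (I : Set α)) (hTI : ∀ t ∈ T, t ∉ I)
    (hW : ∀ v ∈ I, (∃ s ∈ T, v ∈ M.fundCircuit s (I : Set α)) → v ∈ W) (ht : t ∈ T) :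
    t ∈ M.closure (W : Set α) := by
  have hC : M.IsCircuit (M.fundCircuit t (I : Set α)) := hI.fundCircuit_isCircuit (hTcl ht) (hTI t ht)
  have h1 : t ∈ M.closure (M.fundCircuit t (I : Set α) \ {t}) :=
    hC.mem_closure_sdiff_singleton_of_mem (M.mem_fundCircuit t _)
  refine M.closure_subset_closure ?_ h1
  intro a ha
  have haI : a ∈ I := by
    have := M.fundCircuit_subset_insert t (I : Set α) ha.1
    rcases this with h | h
    · exact absurd h ha.2
    · exact_mod_cast h
  exact_mod_cast hW a haI ⟨t, ht, ha.1⟩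

open scoped Classical in
/-- The contradiction at the end of «every pair is bad»: `r((I ∖ W) ∪ T) = |I ∖ W| + 1` is impossible when `T`
holds two distinct extras (the circuit of `f` in `(I ∖ W) ∪ {e}` either is `{e, f}` — too short — or puts an element
of `I ∖ W` into the closure of the rest of `I`). -/
theorem false_of_eRk_sdiff_union_eq [M.Finite] {I W : Finset α} {T : Set α} {e f : α}
    (hcirc : ∀ C, M.IsCircuit C → 3 ≤ C.encard)
    (hI : M.Indep (I : Set α)) (hTE : T ⊆ M.E) (hTcl : T ⊆ M.closure (I : Set α)) (hTI : ∀ t ∈ T, t ∉ I)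
    (hWI : W ⊆ I) (hW : ∀ v ∈ I, v ∈ W ↔ ∃ s ∈ T, v ∈ M.fundCircuit s (I : Set α))
    (he : e ∈ T) (hf : f ∈ T) (hef : e ≠ f)
    (hr : M.eRk (((I : Set α) \ (W : Set α)) ∪ T) = ((I.card - W.card + 1 : ℕ) : ℕ∞)) : False := by
  set J : Set α := (I : Set α) \ (W : Set α) with hJ
  have hJE : J ⊆ M.E := Set.sdiff_subset.trans hI.subset_ground
  have hJr : M.eRk J = ((I.card - W.card : ℕ) : ℕ∞) := eRk_coe_sdiff_coe hI hWI
  -- an extra is outside `cl(J)`: its support meets `W`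
  have hnot : ∀ t ∈ T, t ∉ M.closure J := by
    intro t ht
    have h2 := two_le_card_filter_fundCircuit hcirc hI (hTcl ht) (hTI t ht)
    have hne : (I.filter (fun z => z ∈ M.fundCircuit t (I : Set α))).Nonempty := by
      rw [← Finset.card_pos]; omega
    obtain ⟨x, hx⟩ := hne
    rw [Finset.mem_filter] at hx
    have hxW : x ∈ W := (hW x hx.1).2 ⟨t, ht, hx.2⟩
    refine notMem_closure_of_mem_fundCircuit_of_subset hI (hTcl ht) (hTI t ht) hx.1 hx.2 ?_
    intro a ha
    exact ⟨ha.1, fun h => ha.2 (by rw [Set.mem_singleton_iff.1 h]; exact_mod_cast hxW)⟩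
  have heJ : M.eRk (insert e J) = ((I.card - W.card + 1 : ℕ) : ℕ∞) := by
    rw [Matroid.eRk_insert_eq_add_one ⟨hTE he, hnot e he⟩, hJr]; push_cast; rfl
  have hsub : insert e J ⊆ J ∪ T := Set.insert_subset (Set.mem_union_right _ he) Set.subset_union_left
  have hcl : M.closure (insert e J) = M.closure (J ∪ T) :=
    (M.isRkFinite_set _).closure_eq_closure_of_subset_of_eRk_ge_eRk hsub (by rw [hr, heJ])
  have hfcl : f ∈ M.closure (insert e J) := by
    rw [hcl]; exact M.mem_closure_of_mem (Set.mem_union_right _ hf) (Set.union_subset hJE hTE)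
  have hfnot : f ∉ insert e J := by
    rintro (h | h)
    · exact hef h.symm
    · exact hTI f hf (by exact_mod_cast h.1)
  obtain ⟨C, hCsub, hC, hfC⟩ := (Matroid.mem_closure_iff_exists_isCircuit hfnot).1 hfcl
  by_cases heC : e ∈ C
  · -- `C` has a third element `j ∈ J`
    have hex : ∃ j ∈ C, j ≠ e ∧ j ≠ f := by
      by_contra hcon
      push Not at hcon
      have hCsub' : C ⊆ ({e, f} : Set α) := by
        intro a ha
        by_cases hae : a = e
        · exact Or.inl hae
        · exact Or.inr (hcon a ha hae)
      have h1 := Set.encard_le_encard hCsub'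
      rw [Set.encard_pair hef] at h1
      have h2 := hcirc C hC
      have : (3 : ℕ∞) ≤ 2 := h2.trans h1
      exact absurd this (by decide)
    obtain ⟨j, hjC, hje, hjf⟩ := hex
    have hjJ : j ∈ J := by
      rcases hCsub hjC with h | h | h
      · exact absurd h hjf
      · exact absurd h hje
      · exact h
    have hjI : j ∈ I := by exact_mod_cast hjJ.1
    have hjW : j ∉ W := fun h => hjJ.2 (by exact_mod_cast h)
    -- everything of `C ∖ {j}` lies in `cl(I ∖ {j})`
    have hWsub : (W : Set α) ⊆ (I : Set α) \ {j} := by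
      intro a ha
      exact ⟨hWI (by exact_mod_cast ha), fun h => hjW (by rw [← Set.mem_singleton_iff.1 h]; exact_mod_cast ha)⟩
    have hTcl' : ∀ t ∈ T, t ∈ M.closure ((I : Set α) \ {j}) := fun t ht =>
      M.closure_subset_closure hWsub (mem_closure_coe_of_mem_extras hI hTcl hTI (fun v hv h => (hW v hv).2 h) ht)
    have hCj : C \ {j} ⊆ M.closure ((I : Set α) \ {j}) := by
      intro a ha
      rcases hCsub ha.1 with h | h | h
      · rw [h]; exact hTcl' f hf
      · rw [h]; exact hTcl' e he
      · exact M.mem_closure_of_mem ⟨h.1, ha.2⟩ (Set.sdiff_subset.trans hI.subset_ground)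
    have hj := hC.mem_closure_sdiff_singleton_of_mem hjC
    exact hI.notMem_closure_sdiff_of_mem (by exact_mod_cast hjI)
      (M.closure_subset_closure_of_subset_closure hCj hj)
  · -- `C ⊆ insert f J`, so `f ∈ cl(J)`
    have hCJ : C \ {f} ⊆ J := by
      intro a ha
      rcases hCsub ha.1 with h | h | h
      · exact absurd h ha.2
      · exact absurd (h ▸ ha.1) heC
      · exact h
    exact hnot f hf (M.closure_subset_closure hCJ (hC.mem_closure_sdiff_singleton_of_mem hfC))

open scoped Classical in
/-- «NOT EVERY PAIR IS BAD»: with `W` the union of the supports of the extras `T` (`|W| ≥ 3`, two distinct extras),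
some pair `{x, y} ⊆ W` has `x ∈ cl((I ∖ {x, y}) ∪ T)`. -/
theorem exists_mem_closure_sdiff_pair_union [M.Finite] {I W : Finset α} {T : Set α} {e f : α}
    (hcirc : ∀ C, M.IsCircuit C → 3 ≤ C.encard)
    (hI : M.Indep (I : Set α)) (hTE : T ⊆ M.E) (hTcl : T ⊆ M.closure (I : Set α)) (hTI : ∀ t ∈ T, t ∉ I)
    (hWI : W ⊆ I) (hW : ∀ v ∈ I, v ∈ W ↔ ∃ s ∈ T, v ∈ M.fundCircuit s (I : Set α))
    (he : e ∈ T) (hf : f ∈ T) (hef : e ≠ f) (h3 : 3 ≤ W.card) :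
    ∃ x ∈ W, ∃ y ∈ W, x ≠ y ∧ x ∈ M.closure (((I : Set α) \ {x, y}) ∪ T) := by
  by_contra hall
  push Not at hall
  have hsupp : ∀ v ∈ W, ∃ t ∈ T, t ∉ I ∧ v ∈ M.fundCircuit t (I : Set α) := by
    intro v hv
    obtain ⟨t, ht, hvt⟩ := (hW v (hWI hv)).1 hv
    exact ⟨t, ht, hTI t ht, hvt⟩
  -- the induction: `r((I ∖ S) ∪ T) = |I| − |S| + 1` for every `S ⊆ W` with `|S| ≥ 2`
  have key : ∀ n : ℕ, 2 ≤ n → ∀ S : Finset α, S ⊆ W → S.card = n →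
      M.eRk (((I : Set α) \ (S : Set α)) ∪ T) = ((I.card - n + 1 : ℕ) : ℕ∞) := by
    intro n hn
    induction n, hn using Nat.le_induction with
    | base =>
      intro S hSW hS2
      obtain ⟨x, y, hxy, rfl⟩ := Finset.card_eq_two.1 hS2
      have hxW : x ∈ W := hSW (Finset.mem_insert_self x {y})
      have hyW : y ∈ W := hSW (Finset.mem_insert_of_mem (Finset.mem_singleton_self y))
      obtain ⟨t, ht, htI, hxt⟩ := hsupp x hxW
      have hbad := hall x hxW y hyW hxy
      rw [Finset.coe_pair]
      exact eRk_sdiff_pair_union_of_bad hI hTcl (hTE ht) (hTcl ht) htI ht (hWI hxW) (hWI hyW) hxy hxt hbad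
    | succ n hn ih =>
      intro S hSW hS
      have h2 : 1 < S.card := by omega
      obtain ⟨u, huS, z, hzS, huz⟩ := Finset.one_lt_card.1 h2
      have hu := ih (S.erase u) ((Finset.erase_subset _ _).trans hSW)
        (by rw [Finset.card_erase_of_mem huS, hS]; rfl)
      have hz := ih (S.erase z) ((Finset.erase_subset _ _).trans hSW)
        (by rw [Finset.card_erase_of_mem hzS, hS]; rfl)
      exact eRk_sdiff_union_step n hI hTE hTcl (fun v hv => hsupp v (hSW hv)) (hSW.trans hWI) hS
        (by omega) huS hzS huz hu hz
  have hr := key W.card (by omega) W (Finset.Subset.refl _) rfl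
  exact false_of_eRk_sdiff_union_eq hcirc hI hTE hTcl hTI hWI hW he hf hef hr

/-- Two distinct elements of the ground set of a matroid without circuits of `≤ 2` elements have rank `2`. -/
theorem eRk_pair_eq_two_of_circuits {e f : α} (hcirc : ∀ C, M.IsCircuit C → 3 ≤ C.encard)
    (heE : e ∈ M.E) (hfE : f ∈ M.E) (hef : e ≠ f) : M.eRk ({e, f} : Set α) = 2 := by
  have hsub : ({e, f} : Set α) ⊆ M.E := Set.insert_subset heE (Set.singleton_subset_iff.2 hfE)
  have hind : M.Indep ({e, f} : Set α) := by
    rw [← Matroid.not_dep_iff hsub]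
    intro hdep
    obtain ⟨C, hC, hcirc'⟩ := hdep.exists_isCircuit_subset
    have h1 := Set.encard_le_encard hC
    rw [Set.encard_pair hef] at h1
    have h2 := hcirc C hcirc'
    have : (3 : ℕ∞) ≤ 2 := h2.trans h1
    exact absurd this (by decide)
  rw [hind.eRk_eq_encard, Set.encard_pair hef]

open scoped Classical in
/-- When the support union `W` has exactly three elements, every pair of `W` is good: a bad pair `{a, b}` would
put the four points `T ∪ {c}` (`c` the third element) on a rank-`2` set. -/
theorem mem_closure_sdiff_pair_union_of_card_three [M.Finite] {I W : Finset α} {e f g a b : α}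
    (hcirc : ∀ C, M.IsCircuit C → 3 ≤ C.encard) (hC1 : ∀ L ⊆ M.E, M.eRk L = 2 → L.ncard ≤ 3)
    (hI : M.Indep (I : Set α))
    (hTcl : ({e, f, g} : Set α) ⊆ M.closure (I : Set α)) (hTI : ∀ t ∈ ({e, f, g} : Set α), t ∉ I)
    (hef : e ≠ f) (heg : e ≠ g) (hfg : f ≠ g)
    (hWI : W ⊆ I) (hW : ∀ v ∈ I, v ∈ W ↔ ∃ s ∈ ({e, f, g} : Set α), v ∈ M.fundCircuit s (I : Set α))
    (h3 : W.card = 3) (ha : a ∈ W) (hab : a ≠ b) :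
    a ∈ M.closure (((I : Set α) \ {a, b}) ∪ {e, f, g}) := by
  set T : Set α := {e, f, g} with hT
  have hTE : T ⊆ M.E := hTcl.trans (M.closure_subset_ground _)
  have heT : e ∈ T := by simp [hT]
  have hfT : f ∈ T := by simp [hT]
  have hgT : g ∈ T := by simp [hT]
  -- the third element `c`
  obtain ⟨c, hcW, hca, hcb⟩ : ∃ c ∈ W, c ≠ a ∧ c ≠ b := by
    by_contra hcon
    push Not at hcon
    have hsub : W ⊆ ({a, b} : Finset α) := by
      intro v hv
      by_cases hva : v = a
      · exact Finset.mem_insert.2 (Or.inl hva)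
      · exact Finset.mem_insert.2 (Or.inr (Finset.mem_singleton.2 (hcon v hv hva)))
    have := Finset.card_le_card hsub
    rw [Finset.card_pair hab] at this
    omega
  by_contra hbad
  set Y : Set α := insert c T with hY
  have hYW : Y ⊆ M.closure (W : Set α) := by
    intro y hy
    rcases hy with rfl | hy
    · exact M.mem_closure_of_mem (by exact_mod_cast hcW) ((Finset.coe_subset.2 hWI).trans hI.subset_ground)
    · exact mem_closure_coe_of_mem_extras hI hTcl hTI (fun v hv h => (hW v hv).2 h) hy
  have hYZ : Y ⊆ ((I : Set α) \ {a, b}) ∪ T := by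
    intro y hy
    rcases hy with rfl | hy
    · exact Or.inl ⟨by exact_mod_cast hWI hcW, by
        simp only [Set.mem_insert_iff, Set.mem_singleton_iff, not_or]; exact ⟨hca, hcb⟩⟩
    · exact Or.inr hy
  have hYE : Y ⊆ M.E := hYW.trans (M.closure_subset_ground _)
  have hWind : M.Indep (W : Set α) := hI.subset (by exact_mod_cast hWI)
  -- `r(Y) ≠ 3`
  have hne : M.eRk Y ≠ (W.card : ℕ∞) := by
    intro h
    apply hbad
    have := closure_eq_closure_of_eRk_eq hWind hYW h
    exact M.closure_subset_closure hYZ (this ▸ M.mem_closure_of_mem (by exact_mod_cast ha)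
      ((Finset.coe_subset.2 hWI).trans hI.subset_ground))
  have hle : M.eRk Y ≤ (W.card : ℕ∞) := eRk_le_card_of_subset_closure hWind hYW
  have hge : (2 : ℕ∞) ≤ M.eRk Y := by
    rw [← eRk_pair_eq_two_of_circuits hcirc (hTE heT) (hTE hfT) hef]
    exact M.eRk_mono (by
      intro y hy
      rcases hy with rfl | hy
      · exact Or.inr heT
      · rw [Set.mem_singleton_iff.1 hy]; exact Or.inr hfT)
  obtain ⟨k, hk⟩ := exists_eRk_eq_coe (M := M) Y
  rw [hk] at hne hle hge
  rw [h3] at hne hle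
  have hk2 : k = 2 := by
    have h1 : k ≤ 3 := by exact_mod_cast hle
    have h2 : 2 ≤ k := by exact_mod_cast hge
    have h3' : k ≠ 3 := fun h => hne (by rw [h])
    omega
  have hY2 : M.eRk Y = 2 := by rw [hk, hk2]; rfl
  have hcard := hC1 Y hYE hY2
  -- but `Y` has four points
  have hcT : c ∉ T := fun h => hTI c h (hWI hcW)
  have hY4 : Y.ncard = 4 := by
    rw [hY, Set.ncard_insert_of_notMem hcT (Set.toFinite _), hT,
      Set.ncard_insert_of_notMem (by
        simp only [Set.mem_insert_iff, Set.mem_singleton_iff, not_or]; exact ⟨hef, heg⟩) (Set.toFinite _),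
      Set.ncard_pair hfg]
  omega

end S2

end PercRepro
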